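import Summits.KontsevichZagierPeriods.KontsevichZagierPeriods.Theorems.SoloInformedAlgSwap
import HarnessLib

/-!
# The DEN-calculus over `K`: one step of the vertex-germ induction

Solo programme `solo-KontsevichZagierPeriods-informed`, session s107, step (x-j) of the general
two-dimensional algorithm: **the blow-up step** `soloInformed_vertexGermOK_of_charts`.

Let `F ∈ K[x₀, x₁]` have all monomials of degree `≥ k + 1`.  Suppose finite sets `T₁, T₂` of real
numbers of `K` contain the zeros on `[0,1]` of `F_low(0, ·)` and `(swap F)_low(0, ·)` (the two
charts of the exceptional divisor), and that all child germs of `F` at `T₁` and of `swap F` at `T₂`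
have the vertex-germ property.  Then `F` has the vertex-germ property: for `Q = xᵉ u · U · F`,
RULE DIAG splits the square along the diagonal; the lower chart of `Q` is
`v₀^{e₀+e₁+k} v₁^{e₁} u · U(v₀, v₀v₁) · F_low`, handled by the lower-chart lemma, and the upper
chart is the swap of the lower chart of `swap Q` (`SoloInformedAlgSwap`).

Also: a polynomial not vanishing at `0` has the vertex-germ property (a leaf).

References: M. Kontsevich, D. Zagier, *Periods* (2001), §1.2; J. Kollár, *Lectures on Resolution
of Singularities* (2007), §1.10.
-/

noncomputable section

open scoped BigOperators
open MeasureTheory Set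
open Literature.NumberTheory.Transcendental Literature.NumberTheory.Transcendental.KZ

namespace Summit.KontsevichZagierPeriods.KontsevichZagierPeriods.Theorems

variable {K : Type*} [Field K] [Algebra K ℝ]

/-- A polynomial not vanishing at the vertex `0` has the vertex-germ property. [this work] -/
theorem soloInformed_vertexGermOK_of_apply_zero_ne
    (hK : ∀ c : K, IsAlgebraic ℚ (algebraMap K ℝ c)) {F : MvPolynomial (Fin 2) K}
    (h0 : (MvPolynomial.aeval (0 : Fin 2 → ℝ) F : ℝ) ≠ 0) : SoloInformedVertexGermOK F :=
  fun e _ _ hu hU hF => soloInformed_presentableDenK_monomial_mul_of_forall_ne_zero hK e hu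
    fun y hy => by
      rw [map_mul]
      refine mul_ne_zero (hU y hy) ?_
      by_cases hy0 : y = 0
      · rw [hy0]; exact h0
      · exact hF y hy hy0

omit [Algebra K ℝ] in
/-- A polynomial whose monomials have positive degree has no constant term. [this work] -/
theorem soloInformed_coeff_zero_eq_zero_of_le {F : MvPolynomial (Fin 2) K} {k : ℕ}
    (hm : ∀ a ∈ F.support, k + 1 ≤ a 0 + a 1) : MvPolynomial.coeff 0 F = 0 := by
  by_contra h
  have := hm 0 (MvPolynomial.mem_support_iff.2 h)
  simp at this

/-- The exponent `x₀^A x₁^B` as a finitely supported function. [this work] -/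
theorem soloInformed_single_add_single_apply (A B : ℕ) :
    (Finsupp.single (0 : Fin 2) A + Finsupp.single (1 : Fin 2) B : Fin 2 →₀ ℕ) 0 = A ∧
      (Finsupp.single (0 : Fin 2) A + Finsupp.single (1 : Fin 2) B : Fin 2 →₀ ℕ) 1 = B := by
  constructor <;> simp

/-- Values of `xᵉ u · U · F` at the lower chart point. [this work] -/
theorem soloInformed_aeval_monomial_mul_lowerChart (e : Fin 2 →₀ ℕ) (u : K)
    (U F : MvPolynomial (Fin 2) K) {k : ℕ} (hm : ∀ a ∈ F.support, k + 1 ≤ a 0 + a 1)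
    (v : Fin 2 → ℝ) :
    (MvPolynomial.aeval ![v 0, v 0 * v 1] (MvPolynomial.monomial e u * (U * F)) : ℝ) =
      v 0 * (algebraMap K ℝ u * (v 0 ^ (e 0 + e 1 + k) * v 1 ^ e 1) *
        (MvPolynomial.aeval v (soloInformedLowSubstK U) *
          MvPolynomial.aeval v (soloInformedBlowLowK F (k + 1)))) := by
  rw [map_mul, map_mul, soloInformed_aevalK_monomial, Fin.prod_univ_two,
    soloInformed_aeval_lowerChart_eq_pow_mul_blowLowK F hm, soloInformed_aeval_lowSubstK]
  simp only [Matrix.cons_val_zero, Matrix.cons_val_one]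
  ring

/-- **The blow-up step of the vertex-germ induction.**  See the module docstring. [this work] -/
theorem soloInformed_vertexGermOK_of_charts
    (hK : ∀ c : K, IsAlgebraic ℚ (algebraMap K ℝ c)) {F : MvPolynomial (Fin 2) K} {k : ℕ}
    (hm : ∀ a ∈ F.support, k + 1 ≤ a 0 + a 1)
    (T₁ : Finset ℝ) (hT₁K : ∀ t ∈ T₁, ∃ c : K, algebraMap K ℝ c = t)
    (hT₁ : ∀ t : ℝ, 0 ≤ t → t ≤ 1 →
      (MvPolynomial.aeval ![0, t] (soloInformedBlowLowK F (k + 1)) : ℝ) = 0 → t ∈ T₁)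
    (hchild₁ : ∀ t : K, algebraMap K ℝ t ∈ T₁ → ∀ κ lam : K, 0 < algebraMap K ℝ κ →
      algebraMap K ℝ lam ≠ 0 →
      SoloInformedVertexGermOK (soloInformedChildK F (k + 1) t κ lam))
    (T₂ : Finset ℝ) (hT₂K : ∀ t ∈ T₂, ∃ c : K, algebraMap K ℝ c = t)
    (hT₂ : ∀ t : ℝ, 0 ≤ t → t ≤ 1 →
      (MvPolynomial.aeval ![0, t] (soloInformedBlowLowK (soloInformedSwapK F) (k + 1)) : ℝ) = 0 →
        t ∈ T₂)
    (hchild₂ : ∀ t : K, algebraMap K ℝ t ∈ T₂ → ∀ κ lam : K, 0 < algebraMap K ℝ κ →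
      algebraMap K ℝ lam ≠ 0 →
      SoloInformedVertexGermOK (soloInformedChildK (soloInformedSwapK F) (k + 1) t κ lam)) :
    SoloInformedVertexGermOK F := by
  intro e u U hu hU hF
  set Q := MvPolynomial.monomial e u * (U * F) with hQdef
  have hF0 : MvPolynomial.coeff 0 F = 0 := soloInformed_coeff_zero_eq_zero_of_le hm
  have hQ0 : MvPolynomial.coeff 0 Q = 0 := by
    have h : MvPolynomial.constantCoeff Q = 0 := by
      rw [hQdef, map_mul, map_mul, MvPolynomial.constantCoeff_eq, hF0, mul_zero, mul_zero]
    rwa [MvPolynomial.constantCoeff_eq] at h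
  have hFopen : ∀ x ∈ soloInformedOpenCube 2, (MvPolynomial.aeval x F : ℝ) ≠ 0 := fun x hx =>
    hF x (soloInformedOpenCube_subset_cube 2 hx) fun h => (hx 0).1.ne' (by rw [h]; rfl)
  have hQ : ∀ x ∈ soloInformedOpenCube 2, (MvPolynomial.aeval x Q : ℝ) ≠ 0 := fun x hx => by
    rw [hQdef, map_mul, map_mul, soloInformed_aevalK_monomial]
    exact mul_ne_zero (mul_ne_zero ((map_ne_zero _).2 hu)
      (Finset.prod_ne_zero_iff.2 fun j _ => pow_ne_zero _ (hx j).1.ne'))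
      (mul_ne_zero (hU x (soloInformedOpenCube_subset_cube 2 hx)) (hFopen x hx))
  -- the swapped data
  have hm₂ : ∀ a ∈ (soloInformedSwapK F).support, k + 1 ≤ a 0 + a 1 := fun a ha => by
    obtain ⟨b, hb, h0, h1⟩ := soloInformed_support_swapK ha
    rw [h0, h1, add_comm (b 1)]; exact hm b hb
  have hF₂ : ∀ y ∈ soloInformedCube 2, y ≠ 0 →
      (MvPolynomial.aeval y (soloInformedSwapK F) : ℝ) ≠ 0 := fun y hy hy0 => by
    rw [soloInformed_aeval_swapK]
    refine hF _ (soloInformed_swap_mem_cube hy) fun h => hy0 ?_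
    funext j
    fin_cases j
    · simpa using congr_fun h 1
    · simpa using congr_fun h 0
  have hUlow : ∀ y ∈ soloInformedCube 2,
      (MvPolynomial.aeval y (soloInformedLowSubstK U) : ℝ) ≠ 0 := fun y hy => by
    rw [soloInformed_aeval_lowSubstK]; exact hU _ (soloInformed_lowerChart_mem_cube hy)
  have hU₂low : ∀ y ∈ soloInformedCube 2,
      (MvPolynomial.aeval y (soloInformedLowSubstK (soloInformedSwapK U)) : ℝ) ≠ 0 := fun y hy => by
    rw [soloInformed_aeval_lowSubstK, soloInformed_aeval_swapK]
    exact hU _ (soloInformed_swap_mem_cube (soloInformed_lowerChart_mem_cube hy))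
  refine soloInformed_presentableDenK_of_diag hK Q hQ0 hQ ?_ ?_
  · ----------------------------------------------------------------
    -- the lower chart
    have hL := soloInformed_presentableDenK_blowLow hK hm hF T₁ hT₁K hT₁ hchild₁
      (Finsupp.single 0 (e 0 + e 1 + k) + Finsupp.single 1 (e 1)) hu hUlow
    refine soloInformed_presentableDenK_congr (fun v hv => ?_) hL
    have hv0 : v 0 ≠ 0 := (hv 0).1.ne'
    have hlow := soloInformed_aeval_lowerChart_eq_mul_diagLowerK Q hQ0 v
    rw [soloInformed_lowerChart_eq, hQdef, soloInformed_aeval_monomial_mul_lowerChart e u U F hm v]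
      at hlow
    refine mul_left_cancel₀ hv0 ?_
    rw [← hlow, map_mul, map_mul, soloInformed_aevalK_monomial, Fin.prod_univ_two,
      (soloInformed_single_add_single_apply _ _).1, (soloInformed_single_add_single_apply _ _).2]
  · ----------------------------------------------------------------
    -- the upper chart, through the swap
    refine soloInformed_presentableDenK_diagUpperK_of_swap hK Q hQ0 hQ ?_
    have hL := soloInformed_presentableDenK_blowLow hK hm₂ hF₂ T₂ hT₂K hT₂ hchild₂
      (Finsupp.single 0 (e 0 + e 1 + k) + Finsupp.single 1 (e 0)) hu hU₂low
    refine soloInformed_presentableDenK_congr (fun v hv => ?_) hL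
    have hv0 : v 0 ≠ 0 := (hv 0).1.ne'
    have hQ0' : MvPolynomial.coeff 0 (soloInformedSwapK Q) = 0 := by
      rw [soloInformed_coeff_zero_swapK]; exact hQ0
    have hlow := soloInformed_aeval_lowerChart_eq_mul_diagLowerK (soloInformedSwapK Q) hQ0' v
    rw [soloInformed_lowerChart_eq, soloInformed_aeval_swapK, hQdef, map_mul, map_mul,
      soloInformed_aevalK_monomial, Fin.prod_univ_two] at hlow
    have hFsw : (MvPolynomial.aeval ![(![v 0, v 0 * v 1] : Fin 2 → ℝ) 1, (![v 0, v 0 * v 1] :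
        Fin 2 → ℝ) 0] F : ℝ) = v 0 ^ (k + 1) *
        MvPolynomial.aeval v (soloInformedBlowLowK (soloInformedSwapK F) (k + 1)) := by
      rw [← soloInformed_aeval_lowerChart_eq_pow_mul_blowLowK _ hm₂ v, soloInformed_aeval_swapK]
    have hUsw : (MvPolynomial.aeval ![(![v 0, v 0 * v 1] : Fin 2 → ℝ) 1, (![v 0, v 0 * v 1] :
        Fin 2 → ℝ) 0] U : ℝ) =
        MvPolynomial.aeval v (soloInformedLowSubstK (soloInformedSwapK U)) := by
      rw [soloInformed_aeval_lowSubstK, soloInformed_aeval_swapK]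
    rw [hFsw, hUsw] at hlow
    simp only [Matrix.cons_val_zero, Matrix.cons_val_one] at hlow
    refine mul_left_cancel₀ hv0 ?_
    rw [← hlow, map_mul, map_mul, soloInformed_aevalK_monomial, Fin.prod_univ_two,
      (soloInformed_single_add_single_apply _ _).1, (soloInformed_single_add_single_apply _ _).2]
    ring

end Summit.KontsevichZagierPeriods.KontsevichZagierPeriods.Theorems
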